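import Summits.QuantumFields.YangMills.Theorems.NPointIsotropy.Negative.JunkInvariance
import Summits.QuantumFields.YangMills.Theses.PencilRigidity

/-!
# Negative results on `PencilRigidity.NPointIsotropy`, IV: the model-blind form of the crux is false

Main file 4/4 of the standing disprover's analysis of crux stmt-QuantumFields-11686 (refuter, cdisprove).

`NPointIsotropyModelBlind` is the crux `PencilRigidity.NPointIsotropy` with the two LATTICE clauses of the
curvature package `W₁` deleted (the Wilson-convergence clause and `HasLatticeMassGap`), everything else
verbatim; `npointIsotropy_of_modelBlind` records that it implies the crux. `not_NPointIsotropyModelBlind`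
refutes it: the junk family of file II satisfies every remaining typed hypothesis — E0, E0h, E0', E2 in pull-back
form for ALL eight frames (indeed every frame with `R e₀ ∈ span(e₀,e₁)`), E3, E4, translations, proper
hypercubic invariance, `HasMassGap 1`, and the radial two-point kernel `K = 0` — while its four-point
function is not invariant under the planar rotation `R₀`: `𝔖₄ (R₀ · F₀) = 0 ≠ 𝔖₄ (F₀)` for the bump tensor
`F₀ ∈ ⁰𝒮` centred at `0, 10e₃, 10e₂, 10e₀`.

MORAL (for provers of the crux and planners of its layer 2). The OS clauses as typed only ever evaluate
`𝔖ₙ` on configurations that are time-separated in one of the 16 frames; from `n = 4` on, the exceptional set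
`𝔈ₙ = {x | ∀ n ∈ W(B₄)·{e₀, (e₀+e₁)/√2}, ∃ i ≠ j, ⟪xᵢ - xⱼ, n⟫ = 0}` is not contained in the coincidence
locus, and distributions supported on it are invisible to every hypothesis except the Wilson-limit clause.
Any proof of `NPointIsotropy` must therefore extract from the lattice a regularity statement excluding
singular parts of `𝔖ₙ|_{⁰𝒮}` on `𝔈ₙ` (e.g. local integrability off the coincidence locus, as
`CurvatureKernelBound` provides for `n = 2` only), and the route's model-blind layer-2 children
(`RadialWedgeStandardness → ModularBoostCovarianceRadial`) are false as model-blind statements unless they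
carry such a clause. For GENUINE composite fields the picture is structural (refuter dossier, item
evidence `Disproof.lean` §6): below the `|x|⁻¹⁰` threshold every formally hypercubic Wick polynomial of scalar
generalised free fields is an `O(4)`-scalar (anisotropy needs the rank-4 `W(B₄)`-invariant, dimension ≥ 6),
and internal-index locking (e.g. `Σ (2δ_{μν}-1) :φ_μφ_ν: ∂_μ∂_νψ`, dimension 4, exactly radial two-point
function) breaks E2 at the four-point level — so the typed `K`-hypothesis should carry the sub-threshold
bound, and the honest open question starts above threshold.
-/

noncomputable section

-- Mathlib's `SimplexCategory` instance `Fintype (Fin (x.len + 1))` matches `Fintype (Fin 4)` and makes concrete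
-- `Fin 4` instance paths diverge between elaborations (tree-known workaround, cf.
-- `Literature/Geometry/Riemannian/PieceMetricLocalExtension.lean`).
attribute [-instance] SimplexCategory.instFintypeToTypeOrderHomFinHAddNatLenOfNat

namespace Summit.QuantumFields.YangMills.Theorems.NPointIsotropy.Negative

open scoped BigOperators ComplexConjugate InnerProductSpace
open MeasureTheory Filter Topology
open Literature.MathematicalPhysics.QuantumLattice Literature.MathematicalPhysics.AQFT
  Literature.MathematicalPhysics.QuantumFieldTheory

/-! ## §1 The model-blind strengthening -/

/-- **Model-blind form of the crux**: `NPointIsotropy` with the two lattice clauses of the curvature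
package `W₁` removed (the Wilson-convergence clause and `HasLatticeMassGap`), hence quantified over the
one-species family `S₁` alone; everything else is verbatim. It implies the crux
(`npointIsotropy_of_modelBlind`) and is refuted below (`not_NPointIsotropyModelBlind`). -/
def NPointIsotropyModelBlind : Prop :=
  let E := EuclideanSpace ℝ (Fin 4); ∀ (S₁ : SchwingerFamily E),
    ((S₁.toLabelled.IsNormalized ∧ S₁.toLabelled.IsHermitian ∧ S₁.toLabelled.HasLinearGrowth ∧
        S₁.toLabelled.IsReflectionPositive ∧ S₁.toLabelled.IsSymmetric ∧
        S₁.toLabelled.HasClusterProperty) ∧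
      (∀ (n : ℕ) (a : E) (F : SchwartzMap (Fin n → E) ℂ), IsOffDiagonal F →
        S₁ n (translateMulti a F) = S₁ n F) ∧
      (∀ (R : E ≃ₗᵢ[ℝ] E), LinearMap.det (R.toLinearEquiv : E →ₗ[ℝ] E) = 1 →
        (∀ i : Fin 4, ∃ j : Fin 4, R (EuclideanSpace.single i 1) = EuclideanSpace.single j 1 ∨
          R (EuclideanSpace.single i 1) = -EuclideanSpace.single j 1) →
        ∀ (n : ℕ) (F : SchwartzMap (Fin n → E) ℂ), IsOffDiagonal F →
          S₁ n (linActMulti R F) = S₁ n F) ∧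
      (∃ Δ : ℝ, 0 < Δ ∧ S₁.toLabelled.HasMassGap Δ)) →
    (∀ (R : E ≃ₗᵢ[ℝ] E) (a b : ℝ), a ^ 2 + b ^ 2 = 1 → (a = 0 ∨ b = 0 ∨ a ^ 2 = b ^ 2) →
      R (EuclideanSpace.single 0 1) = a • EuclideanSpace.single 0 1 + b • EuclideanSpace.single 1 1 →
      (SchwingerFamily.toLabelled (fun n => (S₁ n).comp (linActMulti R))).IsReflectionPositive) →
    (∃ K : E → ℝ, ContinuousOn K {x : E | x ≠ 0} ∧ (∀ (R : E ≃ₗᵢ[ℝ] E) (x : E), x ≠ 0 → K (R x) = K x) ∧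
      ∀ F : SchwartzMap (Fin 2 → E) ℂ, IsOffDiagonal F →
        MeasureTheory.Integrable (fun x : Fin 2 → E => (K (x 0 - x 1) : ℂ) * F x) ∧
        S₁ 2 F = ∫ x : Fin 2 → E, (K (x 0 - x 1) : ℂ) * F x) →
    ∀ (R : E ≃ₗᵢ[ℝ] E), LinearMap.det (R.toLinearEquiv : E →ₗ[ℝ] E) = 1 →
      R (EuclideanSpace.single 2 1) = EuclideanSpace.single 2 1 →
      R (EuclideanSpace.single 3 1) = EuclideanSpace.single 3 1 →
      ∀ (n : ℕ) (F : SchwartzMap (Fin n → E) ℂ), IsOffDiagonal F → S₁ n (linActMulti R F) = S₁ n F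

/-- The model-blind form implies the crux (drop the two lattice clauses). [folklore] -/
theorem npointIsotropy_of_modelBlind (h : NPointIsotropyModelBlind) :
    Summit.QuantumFields.YangMills.Theses.PencilRigidity.NPointIsotropy := by
  unfold Summit.QuantumFields.YangMills.Theses.PencilRigidity.NPointIsotropy
  intro E G _ _ _ _ hG
  dsimp only
  intro r sch S₁ hW hRP hK
  obtain ⟨-, hOS, htr, hhyp, Δ, hΔ, hgap, -⟩ := hW
  exact h S₁ ⟨hOS, htr, hhyp, Δ, hΔ, hgap⟩ hRP hK

/-! ### The bump test function -/

/-- Bump centres `0, 10e₃, 10e₂, 10e₀`. -/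
def ctr : Fin 4 → E4 := ![0, (10 : ℝ) • e 3, (10 : ℝ) • e 2, (10 : ℝ) • e 0]

/-- The standard bump of radii `1/2 < 1` at `c`. -/
def bump (c : E4) : ContDiffBump c := ⟨1 / 2, 1, by norm_num, by norm_num⟩

/-- `f₀ (z) = ∏ᵢ bumpᵢ (zᵢ)`. -/
def f₀ (z : Fin 4 → E4) : ℝ := ∏ i, (bump (ctr i)) (z i)

/-- `f₀ ≥ 0`. -/
theorem f₀_nonneg (z : Fin 4 → E4) : 0 ≤ f₀ z :=
  Finset.prod_nonneg fun i _ => (bump (ctr i)).nonneg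

/-- `f₀` is smooth. -/
theorem f₀_contDiff : ContDiff ℝ (⊤ : ℕ∞) f₀ :=
  contDiff_prod fun i _ => (bump (ctr i)).contDiff.comp
    ((ContinuousLinearMap.proj i : (Fin 4 → E4) →L[ℝ] E4).contDiff)

/-- Where `f₀ ≠ 0`, every point lies in the unit ball about its centre. -/
theorem f₀_ball {z : Fin 4 → E4} (hz : f₀ z ≠ 0) (i : Fin 4) : z i ∈ Metric.ball (ctr i) 1 := by
  have h := (Finset.prod_ne_zero_iff.1 hz) i (Finset.mem_univ _)
  have : z i ∈ Function.support (bump (ctr i)) := h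
  rwa [(bump (ctr i)).support_eq] at this

/-- The compact box containing the support. -/
def Kbox : Set (Fin 4 → E4) := Set.pi Set.univ fun i => Metric.closedBall (ctr i) 1

/-- The box is compact. -/
theorem isCompact_Kbox : IsCompact Kbox := isCompact_univ_pi fun i => isCompact_closedBall (ctr i) 1

/-- The box is closed. -/
theorem isClosed_Kbox : IsClosed Kbox := isClosed_set_pi fun _ _ => Metric.isClosed_closedBall

/-- The support of `f₀` lies in the box. -/
theorem f₀_Kbox {z : Fin 4 → E4} (hz : f₀ z ≠ 0) : z ∈ Kbox :=
  fun i _ => Metric.ball_subset_closedBall (f₀_ball hz i)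

/-- The complexified bump tensor as a bare function. -/
def F₀fun (z : Fin 4 → E4) : ℂ := (f₀ z : ℂ)

/-- The complexified bump tensor has compact support. -/
theorem F₀fun_hasCompactSupport : HasCompactSupport F₀fun := by
  refine HasCompactSupport.intro isCompact_Kbox fun z hz => ?_
  by_contra h
  exact hz (f₀_Kbox (by simpa [F₀fun] using h))

/-- The complexified bump tensor is smooth. -/
theorem F₀fun_contDiff : ContDiff ℝ (⊤ : ℕ∞) F₀fun :=
  (Complex.ofRealCLM.contDiff.of_le le_top).comp f₀_contDiff

/-- **The test function** `F₀ ∈ ⁰𝒮((ℝ⁴)⁴)`: bumps of radius `1` at `0, 10e₃, 10e₂, 10e₀`. -/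
def F₀ : SchwartzMap (Fin 4 → E4) ℂ := F₀fun_hasCompactSupport.toSchwartzMap F₀fun_contDiff

/-- Values of `F₀`. -/
theorem F₀_apply (z : Fin 4 → E4) : F₀ z = (f₀ z : ℂ) := rfl

/-- The topological support of `F₀` lies in the box. -/
theorem tsupport_F₀_subset : tsupport (F₀ : (Fin 4 → E4) → ℂ) ⊆ Kbox := by
  refine closure_minimal (fun z hz => ?_) isClosed_Kbox
  exact f₀_Kbox (by simpa [F₀_apply] using hz)

/-- Distinct centres differ by `10` in some coordinate. -/
theorem ctr_sub_coord : ∀ i j : Fin 4, i ≠ j → ∃ k : Fin 4, |(ctr i - ctr j) k| = 10 := by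
  intro i j hij
  fin_cases i <;> fin_cases j
  · exact absurd rfl hij
  · exact ⟨3, by norm_num [ctr, e, Fin.ext_iff]⟩
  · exact ⟨2, by norm_num [ctr, e, Fin.ext_iff]⟩
  · exact ⟨0, by norm_num [ctr, e, Fin.ext_iff]⟩
  · exact ⟨3, by norm_num [ctr, e, Fin.ext_iff]⟩
  · exact absurd rfl hij
  · exact ⟨3, by norm_num [ctr, e, Fin.ext_iff]⟩
  · exact ⟨3, by norm_num [ctr, e, Fin.ext_iff]⟩
  · exact ⟨2, by norm_num [ctr, e, Fin.ext_iff]⟩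
  · exact ⟨2, by norm_num [ctr, e, Fin.ext_iff]⟩
  · exact absurd rfl hij
  · exact ⟨2, by norm_num [ctr, e, Fin.ext_iff]⟩
  · exact ⟨0, by norm_num [ctr, e, Fin.ext_iff]⟩
  · exact ⟨0, by norm_num [ctr, e, Fin.ext_iff]⟩
  · exact ⟨0, by norm_num [ctr, e, Fin.ext_iff]⟩
  · exact absurd rfl hij

/-- The box avoids the coincidence locus (centres are `≥ 10` apart, radii are `1`). -/
theorem Kbox_subset : Kbox ⊆ (coincidenceLocus 4 E4)ᶜ := by
  rintro z hz ⟨i, j, hij, hzij⟩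
  obtain ⟨k, hk⟩ := ctr_sub_coord i j hij
  have hi : ‖z i - ctr i‖ ≤ 1 := by simpa [dist_eq_norm] using hz i (Set.mem_univ _)
  have hj : ‖z j - ctr j‖ ≤ 1 := by simpa [dist_eq_norm] using hz j (Set.mem_univ _)
  have h1 : ‖ctr i - ctr j‖ ≤ 2 := by
    calc ‖ctr i - ctr j‖ = ‖(z j - ctr j) - (z i - ctr i)‖ := by rw [hzij]; congr 1; abel
      _ ≤ ‖z j - ctr j‖ + ‖z i - ctr i‖ := norm_sub_le _ _
      _ ≤ 2 := by linarith
  have h2 : |(ctr i - ctr j) k| ≤ ‖ctr i - ctr j‖ := by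
    simpa [Real.norm_eq_abs] using PiLp.norm_apply_le (ctr i - ctr j) k
  linarith

/-- `F₀ ∈ ⁰𝒮`: it vanishes to infinite order at coincident points (its support avoids them). -/
theorem F₀_isOffDiagonal : IsOffDiagonal F₀ :=
  IsOffDiagonal.of_tsupport_subset (tsupport_F₀_subset.trans Kbox_subset)

/-! ### `J F₀ ≠ 0` -/

/-- The parameter with `A y⋆ = ctr`. -/
def ystar : D7 := (EuclideanSpace.equiv (Fin 7) ℝ).symm ![0, 0, 0, 0, 10, 10, 10]

/-- `A y⋆` is the tuple of centres. -/
theorem A_ystar : A ystar = ctr := by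
  funext i
  have hx : xOf ystar = 0 := by ext j; fin_cases j <;> simp [ystar]
  rw [A_apply, hx, zero_add]
  fin_cases i <;> simp [offset, ctr, ystar, e]

/-- `f₀ (A y⋆) = 1`. -/
theorem f₀_A_ystar : f₀ (A ystar) = 1 := by
  rw [A_ystar, f₀]
  refine Finset.prod_eq_one fun i _ => (bump (ctr i)).one_of_mem_closedBall ?_
  simp [bump]

/-- The identity term of `J F₀` is a positive real number. -/
theorem integral_f₀_A_pos : 0 < ∫ y : D7, f₀ (A y) := by
  have hcont : Continuous fun y : D7 => f₀ (A y) := f₀_contDiff.continuous.comp A.continuous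
  have hint : Integrable (fun y : D7 => f₀ (A y)) := by
    have h1 : Integrable (⇑(SchwartzMap.compCLM ℂ (g := (A : D7 → (Fin 4 → E4)))
        A.hasTemperateGrowth A_upper F₀)) (volume : Measure D7) := SchwartzMap.integrable _
    refine (h1.norm).mono' hcont.aestronglyMeasurable (ae_of_all _ fun y => ?_)
    rw [SchwartzMap.compCLM_apply]
    simp [F₀_apply, Complex.norm_real, Real.norm_eq_abs]
  rw [integral_pos_iff_support_of_nonneg (fun y => f₀_nonneg _) hint]
  have hopen : IsOpen (Function.support fun y : D7 => f₀ (A y)) := by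
    have : Function.support (fun y : D7 => f₀ (A y)) = (fun y : D7 => f₀ (A y)) ⁻¹' {0}ᶜ := by
      ext y; simp
    rw [this]
    exact isOpen_compl_singleton.preimage hcont
  refine hopen.measure_pos volume ⟨ystar, ?_⟩
  simp [f₀_A_ystar]

/-- Real part of `J F₀` as a double sum of real integrals. -/
theorem J_F₀_re : (J F₀).re = ∑ g : WIdx, ∑ π : Equiv.Perm (Fin 4),
    ∫ y : D7, f₀ (fun i => sp g.1 g.2 (A y (π i))) := by
  rw [J_apply, Complex.re_sum]
  refine Finset.sum_congr rfl fun g _ => ?_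
  rw [Complex.re_sum]
  refine Finset.sum_congr rfl fun π _ => ?_
  simp only [F₀_apply]
  rw [integral_complex_ofReal, Complex.ofReal_re]

/-- `Re (J F₀) > 0`: all terms are non-negative and the identity term is positive. -/
theorem J_F₀_re_pos : 0 < (J F₀).re := by
  rw [J_F₀_re]
  have hnn : ∀ (g : WIdx) (π : Equiv.Perm (Fin 4)),
      0 ≤ ∫ y : D7, f₀ (fun i => sp g.1 g.2 (A y (π i))) :=
    fun g π => integral_nonneg fun y => f₀_nonneg _
  refine Finset.sum_pos' (fun g _ => Finset.sum_nonneg fun π _ => hnn g π)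
    ⟨((1 : Equiv.Perm (Fin 4)), fun _ => false), Finset.mem_univ _, ?_⟩
  refine Finset.sum_pos' (fun π _ => hnn _ π) ⟨1, Finset.mem_univ _, ?_⟩
  have : (fun y : D7 => f₀ (fun i => sp (1 : Equiv.Perm (Fin 4)) (fun _ => false) (A y ((1 : Equiv.Perm (Fin 4)) i)))) =
      fun y => f₀ (A y) := by
    funext y
    simp only [sp_one_false, Equiv.Perm.coe_one, id_eq]
  rw [this]
  exact integral_f₀_A_pos

/-! ### `J (R₀ · F₀) = 0` -/

/-- Every offset of the pattern from its base point is an axis vector. -/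
theorem A_sub_axis (y : D7) {k : Fin 4} (hk : k ≠ 0) :
    ∃ (c : ℝ) (m : Fin 4), A y k - A y 0 = c • EuclideanSpace.single m 1 := by
  fin_cases k
  · exact absurd rfl hk
  · exact ⟨y 4, 3, A_one_sub y⟩
  · exact ⟨y 5, 2, A_two_sub y⟩
  · exact ⟨y 6, 0, A_three_sub y⟩

/-- The rotated centres. -/
theorem R₀_ctr (i : Fin 4) :
    R₀ (ctr i) = (![0, (10 : ℝ) • e 3, (10 : ℝ) • e 2, (10 : ℝ) • f0] : Fin 4 → E4) i := by
  have h0 : R₀ (EuclideanSpace.single 0 1) = f0 := R₀_e0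
  fin_cases i <;> simp [ctr, e, h0, R₀_e2, R₀_e3]

/-- Coordinates `0` and `1` of `R₀ (ctr j₀) - R₀ (ctr i₀)` for the pair `(i₀, j₀)` used below. -/
theorem R₀_ctr_sub (i₀ : Fin 4) :
    let j₀ : Fin 4 := if i₀ = 3 then 0 else 3
    |(R₀ (ctr j₀)) 0 - (R₀ (ctr i₀)) 0| = 6 ∧ |(R₀ (ctr j₀)) 1 - (R₀ (ctr i₀)) 1| = 8 := by
  intro j₀
  fin_cases i₀ <;> simp [j₀, R₀_ctr, f0, e] <;> norm_num

/-- **Geometric core**: no signed permutation of the pattern `A y ∘ π` lies bump-wise within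
distance `1` of `R₀⁻¹`-rotated... equivalently `R₀ z = sp(A y ∘ π)` with `z` near the centres is
impossible. -/
theorem no_fit (σ : Equiv.Perm (Fin 4)) (ε : Fin 4 → Bool) (π : Equiv.Perm (Fin 4)) (y : D7)
    (z : Fin 4 → E4) (hz : ∀ i, sp σ ε (A y (π i)) = R₀ (z i))
    (hball : ∀ i, z i ∈ Metric.ball (ctr i) 1) : False := by
  set i₀ : Fin 4 := π.symm 0 with hi₀
  have hπi₀ : π i₀ = 0 := by simp [hi₀]
  set j₀ : Fin 4 := if i₀ = 3 then 0 else 3 with hj₀def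
  have hj₀ : j₀ ≠ i₀ := by
    by_cases h : i₀ = 3
    · rw [hj₀def, if_pos h, h]; decide
    · rw [hj₀def, if_neg h]; exact fun h' => h h'.symm
  have hk0 : π j₀ ≠ 0 := fun h => hj₀ (π.injective (h.trans hπi₀.symm))
  obtain ⟨c, m, hcm⟩ := A_sub_axis y hk0
  -- the rotated difference is an axis vector
  have hw : R₀ (z j₀ - z i₀) = (c * sgn (ε m)) • EuclideanSpace.single (σ m) 1 := by
    rw [map_sub, ← hz j₀, ← hz i₀, hπi₀, ← map_sub, hcm, LinearIsometryEquiv.map_smul, sp_single,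
      mul_one]
    ext k; by_cases hk : k = σ m <;> simp [hk, mul_comm]
  -- it is within 2 of d = R₀ (ctr j₀ - ctr i₀)
  have hd : ‖R₀ (z j₀ - z i₀) - R₀ (ctr j₀ - ctr i₀)‖ < 2 := by
    rw [← map_sub, LinearIsometryEquiv.norm_map]
    have h1 : ‖z j₀ - ctr j₀‖ < 1 := by simpa [dist_eq_norm] using hball j₀
    have h2 : ‖z i₀ - ctr i₀‖ < 1 := by simpa [dist_eq_norm] using hball i₀
    calc ‖z j₀ - z i₀ - (ctr j₀ - ctr i₀)‖ = ‖(z j₀ - ctr j₀) - (z i₀ - ctr i₀)‖ := by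
          congr 1; abel
      _ ≤ ‖z j₀ - ctr j₀‖ + ‖z i₀ - ctr i₀‖ := norm_sub_le _ _
      _ < 2 := by linarith
  obtain ⟨hd0, hd1⟩ := R₀_ctr_sub i₀
  rw [← hj₀def] at hd0 hd1
  have hcoord : ∀ ℓ : Fin 4, |(R₀ (z j₀ - z i₀)) ℓ - ((R₀ (ctr j₀)) ℓ - (R₀ (ctr i₀)) ℓ)| < 2 := by
    intro ℓ
    have h1 := PiLp.norm_apply_le (R₀ (z j₀ - z i₀) - R₀ (ctr j₀ - ctr i₀)) ℓ
    rw [Real.norm_eq_abs, PiLp.sub_apply] at h1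
    have h2 := h1.trans_lt hd
    rwa [map_sub R₀ (ctr j₀) (ctr i₀), PiLp.sub_apply] at h2
  rw [hw] at hcoord
  by_cases hm : σ m = 0
  · have h1 := hcoord 1
    have hne : (1 : Fin 4) ≠ σ m := by rw [hm]; decide
    simp only [PiLp.smul_apply, PiLp.single_apply, if_neg hne, smul_eq_mul, mul_zero, zero_sub,
      abs_neg] at h1
    linarith
  · have h0 := hcoord 0
    have hne : (0 : Fin 4) ≠ σ m := fun h' => hm h'.symm
    simp only [PiLp.smul_apply, PiLp.single_apply, if_neg hne, smul_eq_mul, mul_zero, zero_sub,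
      abs_neg] at h0
    linarith

/-- `J (R₀ · F₀) = 0`: every integrand vanishes identically by `no_fit`. -/
theorem J_R₀F₀ : J (linActMulti R₀ F₀) = 0 := by
  rw [J_apply]
  refine Finset.sum_eq_zero fun g _ => Finset.sum_eq_zero fun π _ => ?_
  have hz : (fun y : D7 => (linActMulti R₀ F₀) (fun i => sp g.1 g.2 (A y (π i)))) = fun _ => 0 := by
    funext y
    rw [linActMulti_apply, F₀_apply]
    by_contra hne
    have hne' : f₀ (fun i => R₀.symm (sp g.1 g.2 (A y (π i)))) ≠ 0 := by
      simpa using hne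
    exact no_fit g.1 g.2 π y _ (fun i => by simp) (f₀_ball hne')
  rw [hz]
  simp

/-- `𝔖₄ (R₀ · F₀) = 0`. -/
theorem junk4_R₀F₀ : junk 4 (linActMulti R₀ F₀) = 0 := J_R₀F₀

/-- `Re 𝔖₄ (F₀) > 0`. -/
theorem junk4_F₀_re_pos : 0 < (junk 4 F₀).re := J_F₀_re_pos

/-! ### The refutation -/

/-- The conclusion of the crux for a one-species family on `ℝ⁴` (named, so that the final step
compares syntactically identical elaborations). -/
def ConclusionOf (S₁ : SchwingerFamily E4) : Prop :=
  ∀ (R : E4 ≃ₗᵢ[ℝ] E4), LinearMap.det (R.toLinearEquiv : E4 →ₗ[ℝ] E4) = 1 →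
    R (EuclideanSpace.single 2 1) = EuclideanSpace.single 2 1 →
    R (EuclideanSpace.single 3 1) = EuclideanSpace.single 3 1 →
    ∀ (n : ℕ) (F : SchwartzMap (Fin n → E4) ℂ), IsOffDiagonal F → S₁ n (linActMulti R F) = S₁ n F

set_option maxRecDepth 8000 in
set_option maxHeartbeats 1600000 in
/-- The junk family violates the conclusion: `𝔖₄(R₀·F₀) = 0 ≠ 𝔖₄(F₀)`. (The raised recursion
depth/heartbeats are only needed to compare two elaborations of `𝔖₄(R₀·F₀)` that differ in
auxiliary instance-proof constants.) -/
theorem not_conclusionOf_junk : ¬ ConclusionOf junk := by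
  intro hc
  have h1 := hc R₀ R₀_det R₀_e2 R₀_e3 4 F₀ F₀_isOffDiagonal
  have h5 : (0 : ℂ) = junk 4 F₀ := junk4_R₀F₀.symm.trans h1
  have h6 := congrArg Complex.re h5
  rw [Complex.zero_re] at h6
  exact absurd h6 (ne_of_lt junk4_F₀_re_pos)

/-- The junk family meets every hypothesis of the model-blind form, whence its conclusion. -/
theorem conclusionOf_junk_of_modelBlind (h : NPointIsotropyModelBlind) : ConclusionOf junk := by
  have hK : ∃ K : E4 → ℝ, ContinuousOn K {x : E4 | x ≠ 0} ∧
      (∀ (R : E4 ≃ₗᵢ[ℝ] E4) (x : E4), x ≠ 0 → K (R x) = K x) ∧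
      ∀ F : SchwartzMap (Fin 2 → E4) ℂ, IsOffDiagonal F →
        MeasureTheory.Integrable (fun x : Fin 2 → E4 => (K (x 0 - x 1) : ℂ) * F x) ∧
        junk 2 F = ∫ x : Fin 2 → E4, (K (x 0 - x 1) : ℂ) * F x := by
    refine ⟨fun _ => 0, continuousOn_const, fun _ _ _ => rfl, fun F _ => ⟨?_, ?_⟩⟩
    · simp
    · simp [junk_of_ne (show (2 : ℕ) ≠ 0 by decide) (show (2 : ℕ) ≠ 4 by decide)]
  exact h junk ⟨⟨junk_isNormalized, junk_isHermitian, junk_hasLinearGrowth, junk_rp,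
      junk_isSymmetric, junk_hasClusterProperty⟩, fun n a F _ => junk_translate n a F,
      fun R _ hR n F _ => junk_hyper n hR F, ⟨1, one_pos, junk_hasMassGap 1⟩⟩
    (fun R a b _ _ hR => junk_frame_rp R a b hR) hK

/-- **Theorem (the lattice clause is load-bearing).** The model-blind form of `NPointIsotropy` is
false: the junk family satisfies every non-lattice hypothesis of the crux (E0, E0h, E0', E2 in all
eight frames, E3, E4, translations, proper hypercubic invariance, mass gap `Δ = 1`, two-point kernel
`K = 0`) and its four-point function is not invariant under the planar rotation `R₀`. -/
theorem not_NPointIsotropyModelBlind : ¬ NPointIsotropyModelBlind :=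
  fun h => not_conclusionOf_junk (conclusionOf_junk_of_modelBlind h)

end Summit.QuantumFields.YangMills.Theorems.NPointIsotropy.Negative

end
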